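import Summits.HodgeConjecture.HodgeConjecture.Theorems.MarkmanPartnerTransportPicardThreeK3SquaresOneCycle

/-!
# Route MarkmanPartnerTransport · crux `PicardThreeK3Squares` (stmt-HodgeConjecture-19652) —
# ONE CYCLE SUFFICES, part 3: the Hodge conjecture for `S × S` from ONE algebraic self-correspondence
# acting on the `2`-form by an irrational number (`ρ(S) ∉ {2, 4, 6, 10}`)

Conclusion of the line «one cycle suffices» (prover 19652-p1 g8; parts 1–2:
`…OneCycleAlgebra`, `…OneCycle`). For a projective K3 surface `S` whose Picard number satisfies
`d · m + ρ(S) = 22, d ≥ 2, m ≥ 3 ⟹ d prime` — every `ρ(S) ∉ {2, 4, 6, 10}` (`prime_of_mul_add_eq`) —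
and ONE `ℂ`-linear endomorphism `e` of `H²(S(ℂ); ℂ)` that (i) preserves rational classes and Hodge
types, (ii) is induced by an algebraic class on `S × S` (`e = pr₁_*(pr₂^*(–) ∪ γ)`, `γ ∈ N²H⁴(S × S)`,
any orientation family), and (iii) acts on a non-zero `(2,0)`-class by a NON-RATIONAL scalar:

* `hodgeConjectureFor_square_of_oneCycle` — if `S` is not of CM type: `HodgeConjectureFor 4 (S ⊗ S)`,
  granted markings only (`generatedBy_or_hasComplexMultiplication_of_eigenvalue` +
  `hodgeConjectureFor_square_of_generatedBy_of_mapsTo` + `mapsTo_algebraicClasses_one`);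
* `hodgeConjectureFor_square_of_oneCycle_of_buskin` — for every `S`: the CM branch by Buskin's Thm. 1.1
  (`CMThird.hodgeConjectureFor_square_of_CM_of_buskin`);
* `hodgeConjectureFor_square_of_oneCycle_of_picard` — the same with the hypothesis spelled
  `ρ(S) ≠ 2, 4, 6, 10`;
* `hodgeConjectureFor_square_of_cycleInduced_of_eigenvalue` — in van Geemen–Schütt's vocabulary: a
  cycle-induced transcendental endomorphism (`IsCycleInducedTranscendentalEndomorphism`, the shape of
  the six `VanGeemenSchuett2025_rmK3_cycleInduced_*` facts) with a non-rational `(2,0)`-eigenvalue gives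
  HC⁴(S ⊗ S) at these Picard numbers — the clauses `IsAnnihilatedOnTranscendentalBy` /
  `TranscendentalEndomorphismsGeneratedBy` (identification of `End_Hdg(T(S))`) are NOT needed there.

So on the real-multiplication residue of the crux with `ρ(S) ∈ {7, 8, 12, 13, 14, 16}` (and at the
free ranks) the open content is exactly «one algebraic self-correspondence of `S` acting on `ω_S` by an
irrational number» — the printed shape of every known source (van Geemen–Schütt 2025 §4.8: `Γ₁ + Γ₋₁`
from an automorphism of a dominating surface; §6.4: the graph of a rational self-map of degree `2`,
`φ'∘ψ` acting on `ω` by `√2`), with no Hodge-theoretic determination of `E` required. At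
`ρ(S) ∈ {4, 6, 10}` (`22 - ρ ∈ {18, 16, 12}`: `[E:ℚ] ∈ {6, 4, 4}` possible) one cycle generates only a
subfield and the generation clause (or a second cycle) remains necessary.

No definition, no sorry; named facts (`Huybrechts_K3_marking_exists`, `Buskin2019_hodgeIsometry_algebraic`)
only as hypotheses. Prover seat hodge-nonav-19652-p1 (gen 8), `--supports stmt-HodgeConjecture-19652`.
Nothing here proves the crux or the Hodge conjecture.

References: van Geemen–Schütt, Forum Math. Sigma 13 (2025) e2, §2.1, §4.8, Rem. 4.9, §6.4; Varesco,
Math. Z. 305 (2023), §2 (p. 8); van Geemen, Michigan Math. J. 56 (2008), Lemma 3.2; Zarhin, J. reine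
angew. Math. 341 (1983), Thm. 1.5.1; Buskin, J. reine angew. Math. 755 (2019), Thm. 1.1.
-/

set_option linter.dupNamespace false

noncomputable section

namespace Summit.HodgeConjecture.HodgeConjecture.Theorems.MarkmanPartnerTransport.OneCycle

open scoped Manifold TensorProduct
open Module CategoryTheory MonoidalCategory CartesianMonoidalCategory Polynomial
open Literature.AlgebraicGeometry Literature.AlgebraicGeometry.Motives Literature.AlgebraicGeometry.HodgeTheory
open Literature.AlgebraicGeometry.Surfaces
open Literature.AlgebraicTopology.SingularHomology
open Summit.HodgeConjecture.HodgeConjecture.Theorems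

/-- `Corr[μ, hS ; γ, y] = pr₁_*(pr₂^* y ∪ γ)` on `H²(S(ℂ); ℂ)`. Local notation only. -/
local notation3 (prettyPrint := false) "Corr[" μ ", " hS " ; " γ ", " y "]" =>
  complexGysin μ (IsSmoothProjective.tensor_holds hS hS) hS
    (SemiCartesianMonoidalCategory.fst _ _) (rfl : 2 * 1 + 2 * 2 + 2 * 2 = 2 * 1 + 2 * (2 + 2))
    (cupProduct (rfl : 2 * 1 + 2 * 2 = 2 * 1 + 2 * 2)
      (complexBetti.map (SemiCartesianMonoidalCategory.snd _ _) (2 * 1) y) γ)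

variable {S : SchemeOver ℂ}

/-- **ONE CYCLE SUFFICES (non-CM surfaces; markings only).** Let `S` be a projective K3 surface, not of
CM type, with `d · m + ρ(S) = 22, d ≥ 2, m ≥ 3 ⟹ d prime` (e.g. `ρ(S) ∉ {2, 4, 6, 10}`), and `e` an
endomorphism of `H²(S(ℂ); ℂ)` preserving rational classes and Hodge types, induced by an algebraic class
on `S × S` for some orientation family `μ`, whose eigenvalue on a non-zero `(2,0)`-class is not rational.
Then `HodgeConjectureFor 4 (S ⊗ S)`: `End_Hdg(T(S)) = ℚ[e|_T]`
(`generatedBy_or_hasComplexMultiplication_of_eigenvalue`, CM excluded), `e` is `N¹`-stable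
(`mapsTo_algebraicClasses_one`), and the `N¹`-stable rung F4 concludes.
[cite: Varesco2023, §2 (p. 8)] [cite: GeemenSchutt2023, §4.8 and Rem. 4.9]
[cite: Vangeemen2008, Lemma 3.2] [cite: Zarhin1983HodgeGroupsK3, Thm. 1.5.1] -/
theorem hodgeConjectureFor_square_of_oneCycle (hmark : Huybrechts_K3_marking_exists) (hS : IsK3Surface S)
    (hρ : ∀ d m : ℕ, 2 ≤ d → 3 ≤ m → d * m + Module.finrank ℂ ↥(algebraicClasses S 1) = 22 → d.Prime)
    (hCM : ¬ HasComplexMultiplication S) (μ : OrientationFamily)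
    (e : complexBetti S (2 * 1) →ₗ[ℂ] complexBetti S (2 * 1))
    (he_rat : ∀ y, IsRationalClass y → IsRationalClass (e y))
    (he_typ : ∀ (i j : ℕ) y, IsOfHodgeType 2 S (2 * 1) i j y → IsOfHodgeType 2 S (2 * 1) i j (e y))
    (he_cyc : ∃ γ ∈ algebraicClasses (S ⊗ S) 2, ∀ y : complexBetti S (2 * 1),
      e y = Corr[μ, hS.isSmoothProjective ; γ, y])
    (he_ev : ∃ (σ₀ : complexBetti S (2 * 1)) (ev : ℂ), IsOfHodgeType 2 S (2 * 1) 2 0 σ₀ ∧ σ₀ ≠ 0 ∧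
      e σ₀ = ev • σ₀ ∧ ∀ a : ℚ, (a : ℂ) ≠ ev) :
    HodgeConjectureFor 4 (S ⊗ S) := by
  rcases generatedBy_or_hasComplexMultiplication_of_eigenvalue hmark hS hρ e he_rat he_typ he_ev with
    hgen | hCM'
  · exact hodgeConjectureFor_square_of_generatedBy_of_mapsTo μ hS.isSmoothProjective e
      (mapsTo_algebraicClasses_one hS.isSmoothProjective e he_rat he_typ) he_cyc hgen
  · exact absurd hCM' hCM

/-- **ONE CYCLE SUFFICES (every projective K3 surface; CM branch by Buskin's Thm. 1.1).** As
`hodgeConjectureFor_square_of_oneCycle`, without the non-CM hypothesis: if `S` turns out to have complex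
multiplication, `HodgeConjectureFor 4 (S ⊗ S)` is `CMThird.hodgeConjectureFor_square_of_CM_of_buskin`.
[cite: Buskin2019, Thm. 1.1] [cite: Varesco2023, §2 (p. 8)] [cite: GeemenSchutt2023, §4.8 and Rem. 4.9] -/
theorem hodgeConjectureFor_square_of_oneCycle_of_buskin (hB : Buskin2019_hodgeIsometry_algebraic)
    (hmark : Huybrechts_K3_marking_exists) (hS : IsK3Surface S)
    (hρ : ∀ d m : ℕ, 2 ≤ d → 3 ≤ m → d * m + Module.finrank ℂ ↥(algebraicClasses S 1) = 22 → d.Prime)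
    (μ : OrientationFamily) (e : complexBetti S (2 * 1) →ₗ[ℂ] complexBetti S (2 * 1))
    (he_rat : ∀ y, IsRationalClass y → IsRationalClass (e y))
    (he_typ : ∀ (i j : ℕ) y, IsOfHodgeType 2 S (2 * 1) i j y → IsOfHodgeType 2 S (2 * 1) i j (e y))
    (he_cyc : ∃ γ ∈ algebraicClasses (S ⊗ S) 2, ∀ y : complexBetti S (2 * 1),
      e y = Corr[μ, hS.isSmoothProjective ; γ, y])
    (he_ev : ∃ (σ₀ : complexBetti S (2 * 1)) (ev : ℂ), IsOfHodgeType 2 S (2 * 1) 2 0 σ₀ ∧ σ₀ ≠ 0 ∧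
      e σ₀ = ev • σ₀ ∧ ∀ a : ℚ, (a : ℂ) ≠ ev) :
    HodgeConjectureFor 4 (S ⊗ S) := by
  rcases generatedBy_or_hasComplexMultiplication_of_eigenvalue hmark hS hρ e he_rat he_typ he_ev with
    hgen | hCM
  · exact hodgeConjectureFor_square_of_generatedBy_of_mapsTo μ hS.isSmoothProjective e
      (mapsTo_algebraicClasses_one hS.isSmoothProjective e he_rat he_typ) he_cyc hgen
  · exact CMThird.hodgeConjectureFor_square_of_CM_of_buskin hB hmark S hS hCM

/-- **ONE CYCLE SUFFICES at every Picard number `ρ(S) ∉ {2, 4, 6, 10}`** — in particular on the whole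
range `ρ(S) ≥ 3` of the crux `PicardThreeK3Squares` except `ρ(S) ∈ {4, 6, 10}`: a projective K3 surface
carrying ONE algebraic self-correspondence whose action on `H²` (rational, type-preserving) has a
non-rational eigenvalue on the `2`-form satisfies the Hodge conjecture for `S ⊗ S`, modulo Buskin's
Thm. 1.1 (CM branch) and markings. [cite: GeemenSchutt2023, §4.8, Rem. 4.9 and §6.4]
[cite: Vangeemen2008, Lemma 3.2] [cite: Buskin2019, Thm. 1.1] -/
theorem hodgeConjectureFor_square_of_oneCycle_of_picard (hB : Buskin2019_hodgeIsometry_algebraic)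
    (hmark : Huybrechts_K3_marking_exists) (hS : IsK3Surface S)
    (h2 : Module.finrank ℂ ↥(algebraicClasses S 1) ≠ 2) (h4 : Module.finrank ℂ ↥(algebraicClasses S 1) ≠ 4)
    (h6 : Module.finrank ℂ ↥(algebraicClasses S 1) ≠ 6) (h10 : Module.finrank ℂ ↥(algebraicClasses S 1) ≠ 10)
    (μ : OrientationFamily) (e : complexBetti S (2 * 1) →ₗ[ℂ] complexBetti S (2 * 1))
    (he_rat : ∀ y, IsRationalClass y → IsRationalClass (e y))
    (he_typ : ∀ (i j : ℕ) y, IsOfHodgeType 2 S (2 * 1) i j y → IsOfHodgeType 2 S (2 * 1) i j (e y))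
    (he_cyc : ∃ γ ∈ algebraicClasses (S ⊗ S) 2, ∀ y : complexBetti S (2 * 1),
      e y = Corr[μ, hS.isSmoothProjective ; γ, y])
    (he_ev : ∃ (σ₀ : complexBetti S (2 * 1)) (ev : ℂ), IsOfHodgeType 2 S (2 * 1) 2 0 σ₀ ∧ σ₀ ≠ 0 ∧
      e σ₀ = ev • σ₀ ∧ ∀ a : ℚ, (a : ℂ) ≠ ev) :
    HodgeConjectureFor 4 (S ⊗ S) :=
  hodgeConjectureFor_square_of_oneCycle_of_buskin hB hmark hS
    (fun _ _ hd hm h ↦ prime_of_mul_add_eq h2 h4 h6 h10 hd hm h) μ e he_rat he_typ he_cyc he_ev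

/-- **In van Geemen–Schütt's vocabulary: a cycle-induced transcendental endomorphism with a
non-rational `(2,0)`-eigenvalue decides HC⁴(S ⊗ S) at `ρ(S) ∉ {2, 4, 6, 10}`** — the clauses
`IsAnnihilatedOnTranscendentalBy` (minimal polynomial) and `TranscendentalEndomorphismsGeneratedBy`
(`End_Hdg(T) = ℚ[t|_T]`) of `IsCycleInducedRMK3` are not needed there: for a projective K3 surface `S`
and `t` with `IsCycleInducedTranscendentalEndomorphism S _ t` (rational, type-preserving, kills `N¹`,
image `⊥ N¹`, induced by an algebraic class on `S × S`) acting on a non-zero `(2,0)`-class by a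
non-rational scalar, `HodgeConjectureFor 4 (S ⊗ S)` (mod Buskin Thm. 1.1 and markings).
[cite: GeemenSchutt2023, §4.8 and Rem. 4.9] [cite: Varesco2023, §2 (p. 8)] [cite: Buskin2019, Thm. 1.1] -/
theorem hodgeConjectureFor_square_of_cycleInduced_of_eigenvalue (hB : Buskin2019_hodgeIsometry_algebraic)
    (hmark : Huybrechts_K3_marking_exists) (hS : IsK3Surface S)
    (h2 : Module.finrank ℂ ↥(algebraicClasses S 1) ≠ 2) (h4 : Module.finrank ℂ ↥(algebraicClasses S 1) ≠ 4)
    (h6 : Module.finrank ℂ ↥(algebraicClasses S 1) ≠ 6) (h10 : Module.finrank ℂ ↥(algebraicClasses S 1) ≠ 10)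
    (t : complexBetti S (2 * 1) →ₗ[ℂ] complexBetti S (2 * 1))
    (ht : IsCycleInducedTranscendentalEndomorphism S hS.isSmoothProjective t)
    (ht_ev : ∃ (σ₀ : complexBetti S (2 * 1)) (ev : ℂ), IsOfHodgeType 2 S (2 * 1) 2 0 σ₀ ∧ σ₀ ≠ 0 ∧
      t σ₀ = ev • σ₀ ∧ ∀ a : ℚ, (a : ℂ) ≠ ev) :
    HodgeConjectureFor 4 (S ⊗ S) := by
  obtain ⟨hrat, htyp, -, -, hcyc⟩ := ht
  exact hodgeConjectureFor_square_of_oneCycle_of_picard hB hmark hS h2 h4 h6 h10 complexOrientationFamily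
    t hrat htyp hcyc ht_ev

end Summit.HodgeConjecture.HodgeConjecture.Theorems.MarkmanPartnerTransport.OneCycle

end
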